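import Mathlib
import Summits.AtomisticToContinuum.Crystallization.Theorems.PalmUnimodularRigidityShellsToBarlowChartCubicGrowth

/-!
# `CleanLimitsHaveWindows` (stmt-AtomisticToContinuum-15932), line `Sketch` — helper for stub K1
# (`stub_cleanChart`): connectivity and cubic growth of the window graph of a clean set

Stub K1 is proved by re-running the development of the crux `ShellsToBarlowChart` (route
`PalmUnimodularRigidity`) on clean charts.  Its growth descent needs two inputs about the rescaled clean
set `S` (bond length `b = 56/51`, so that "bonded" is "distance in `(0, 28/25]`", the window of that
development): the window graph of `S` is CONNECTED, and its balls grow CUBICALLY.  Both follow, as in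
`PalmUnimodularRigidityShellsToBarlowChartCubicGrowth.lean`, from greedy walks; the inputs here are the
radial clause of cleanness at scale `b` (hard core `0.98 b`, bonds `≤ 1.02 b = 28/25`, empty annulus up
to `1.26 b`) and a DIRECTION clause (for every direction some bonded neighbour makes an angle of cosine
`≥ 0.556/1.12` with it; supplied by the charts, file `…CleanChartCharts`):

* `clean_exists_walk` — every `z ∈ S` with `dist x z ≤ 1.26 b + m/10` is joined to `x` by a walk of
  length `≤ m + 2` (a greedy step towards a far target gains `1/10`); hence `clean_connected`;
* `clean_exists_near` — covering radius `< 6/5`;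
* `clean_cubicGrowth` — `(n/13)³ ≤ #Ball_n(x)` for `n ≥ 12` (volume count, hard core `> 1`).
-/

noncomputable section

namespace Summit.AtomisticToContinuum.Crystallization.Theorems.CleanHull

open Summit.AtomisticToContinuum.Crystallization.Theorems.PalmUnimodularRigidityShellsToBarlowChart
open MeasureTheory Metric
open scoped ENNReal NNReal

section Growth

variable {S : Set (EuclideanSpace ℝ (Fin 3))}

/-- Two distinct points of `S` at distance `≤ 28/25` are adjacent in the window graph. [folklore] -/
theorem clean_adj_of_dist_le {y z : EuclideanSpace ℝ (Fin 3)} (hy : y ∈ S) (hz : z ∈ S) (hne : y ≠ z)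
    (hd : dist y z ≤ 28 / 25) : (windowGraph S).Adj y z := by
  rw [windowGraph, SimpleGraph.fromRel_adj]
  exact ⟨hne, Or.inl ⟨hy, hz, dist_pos.2 hne, hd⟩⟩

/-- **The greedy step.** From `x ∈ S` towards any target `z` there is an adjacent `y` with
`dist(y, z)² ≤ dist(x, z)² − 1.112·dist(x, z) + 1.2544`. [folklore] -/
theorem clean_exists_step
    (hdir : ∀ x ∈ S, ∀ d : EuclideanSpace ℝ (Fin 3), ∃ y ∈ S, y ≠ x ∧ dist x y ≤ 28 / 25 ∧
      139 / 250 * ‖d‖ ≤ inner ℝ (y - x) d)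
    {x : EuclideanSpace ℝ (Fin 3)} (hx : x ∈ S) (z : EuclideanSpace ℝ (Fin 3)) :
    ∃ y ∈ S, (windowGraph S).Adj x y ∧
      dist y z ^ 2 ≤ dist x z ^ 2 - 278 / 250 * dist x z + 784 / 625 := by
  obtain ⟨y, hy, hne, hd, hinner⟩ := hdir x hx (z - x)
  refine ⟨y, hy, clean_adj_of_dist_le hx hy (Ne.symm hne) hd, ?_⟩
  have key : dist y z ^ 2 = ‖y - x‖ ^ 2 - 2 * inner ℝ (y - x) (z - x) + ‖z - x‖ ^ 2 := by
    rw [dist_eq_norm, ← norm_sub_sq_real, sub_sub_sub_cancel_right]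
  have h1 : ‖y - x‖ ≤ 28 / 25 := by rw [← dist_eq_norm, dist_comm]; exact hd
  have h2 : ‖z - x‖ = dist x z := by rw [dist_comm, dist_eq_norm]
  rw [key, h2]
  rw [h2] at hinner
  nlinarith [mul_le_mul h1 h1 (norm_nonneg _) (by positivity), norm_nonneg (y - x)]

/-- Far from the target (`r ≥ 1.26 b = 3528/2550`) a greedy step gains `1/10`. [folklore] -/
theorem clean_step_far {r : ℝ} (hr : 3528 / 2550 ≤ r) :
    r ^ 2 - 278 / 250 * r + 784 / 625 ≤ (r - 1 / 10) ^ 2 := by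
  nlinarith

/-- At distance `≥ 6/5` from the target a greedy step decreases the squared distance by `2/25`.
[folklore] -/
theorem clean_step_cover {r : ℝ} (hr : 6 / 5 ≤ r) :
    r ^ 2 - 278 / 250 * r + 784 / 625 ≤ r ^ 2 - 2 / 25 := by
  nlinarith

/-- **Greedy walks.** Every `x ∈ S` with `dist(x, z) ≤ 1.26 b + m/10`, `z ∈ S`, is joined to `z` by a
walk of length `≤ m + 2` in the window graph. [folklore] -/
theorem clean_exists_walk
    (hrad : ∀ y ∈ S, ∀ w ∈ S, w ≠ y → 2744 / 2550 ≤ dist y w ∧ (dist y w ≤ 28 / 25 ∨ 3528 / 2550 ≤ dist y w))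
    (hdir : ∀ x ∈ S, ∀ d : EuclideanSpace ℝ (Fin 3), ∃ y ∈ S, y ≠ x ∧ dist x y ≤ 28 / 25 ∧
      139 / 250 * ‖d‖ ≤ inner ℝ (y - x) d)
    {z : EuclideanSpace ℝ (Fin 3)} (hz : z ∈ S) :
    ∀ m : ℕ, ∀ x ∈ S, dist x z ≤ 3528 / 2550 + (m : ℝ) / 10 →
      ∃ w : (windowGraph S).Walk x z, w.length ≤ m + 2 := by
  -- one bond, or equal: targets within `1.26 b` strictly
  have hclose : ∀ x ∈ S, dist x z < 3528 / 2550 → ∃ w : (windowGraph S).Walk x z, w.length ≤ 1 := by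
    intro x hx hd
    by_cases hxz : x = z
    · subst hxz
      exact ⟨SimpleGraph.Walk.nil, by simp⟩
    · rcases (hrad x hx z hz (Ne.symm hxz)).2 with h | h
      · exact ⟨SimpleGraph.Walk.cons (clean_adj_of_dist_le hx hz hxz h) SimpleGraph.Walk.nil, by simp⟩
      · exact absurd hd (not_lt.2 h)
  intro m
  induction m with
  | zero =>
    intro x hx hd
    by_cases hlt : dist x z < 3528 / 2550
    · obtain ⟨w, hw⟩ := hclose x hx hlt
      exact ⟨w, by omega⟩
    · push Not at hlt
      obtain ⟨y, hy, hadj, hest⟩ := clean_exists_step hdir hx z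
      have h2 : dist y z ^ 2 ≤ (dist x z - 1 / 10) ^ 2 := hest.trans (clean_step_far hlt)
      have hyz : dist y z ≤ dist x z - 1 / 10 := (abs_le_of_sq_le_sq' h2 (by linarith)).2
      have hyz' : dist y z < 3528 / 2550 := by
        have : dist x z ≤ 3528 / 2550 := by simpa using hd
        linarith
      obtain ⟨w, hw⟩ := hclose y hy hyz'
      exact ⟨SimpleGraph.Walk.cons hadj w, by rw [SimpleGraph.Walk.length_cons]; omega⟩
  | succ m ih =>
    intro x hx hd
    by_cases hle : dist x z ≤ 3528 / 2550 + (m : ℝ) / 10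
    · obtain ⟨w, hw⟩ := ih x hx hle
      exact ⟨w, by omega⟩
    push Not at hle
    obtain ⟨y, hy, hadj, hest⟩ := clean_exists_step hdir hx z
    have h32 : 3528 / 2550 ≤ dist x z := by
      have : (0 : ℝ) ≤ (m : ℝ) / 10 := by positivity
      linarith
    have h2 : dist y z ^ 2 ≤ (dist x z - 1 / 10) ^ 2 := hest.trans (clean_step_far h32)
    have hyz : dist y z ≤ dist x z - 1 / 10 := (abs_le_of_sq_le_sq' h2 (by linarith)).2
    have hyz' : dist y z ≤ 3528 / 2550 + (m : ℝ) / 10 := by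
      push_cast at hd
      linarith
    obtain ⟨w, hw⟩ := ih y hy hyz'
    exact ⟨SimpleGraph.Walk.cons hadj w, by rw [SimpleGraph.Walk.length_cons]; omega⟩

/-- **The window graph of a clean set is connected.** [folklore] -/
theorem clean_connected
    (hrad : ∀ y ∈ S, ∀ w ∈ S, w ≠ y → 2744 / 2550 ≤ dist y w ∧ (dist y w ≤ 28 / 25 ∨ 3528 / 2550 ≤ dist y w))
    (hdir : ∀ x ∈ S, ∀ d : EuclideanSpace ℝ (Fin 3), ∃ y ∈ S, y ≠ x ∧ dist x y ≤ 28 / 25 ∧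
      139 / 250 * ‖d‖ ≤ inner ℝ (y - x) d) :
    ∀ x ∈ S, ∀ y ∈ S, Nonempty ((windowGraph S).Walk x y) := by
  intro x hx y hy
  have hm : dist x y ≤ 3528 / 2550 + ((⌈10 * dist x y⌉₊ : ℕ) : ℝ) / 10 := by
    have h1 : 10 * dist x y ≤ ((⌈10 * dist x y⌉₊ : ℕ) : ℝ) := Nat.le_ceil _
    linarith [dist_nonneg (x := x) (y := y)]
  obtain ⟨w, -⟩ := clean_exists_walk hrad hdir hy ⌈10 * dist x y⌉₊ x hx hm
  exact ⟨w⟩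

/-- **Covering radius `< 6/5`** (greedy descent of the squared distance by `2/25` per step).
[folklore] -/
theorem clean_exists_near_aux
    (hdir : ∀ x ∈ S, ∀ d : EuclideanSpace ℝ (Fin 3), ∃ y ∈ S, y ≠ x ∧ dist x y ≤ 28 / 25 ∧
      139 / 250 * ‖d‖ ≤ inner ℝ (y - x) d)
    (p : EuclideanSpace ℝ (Fin 3)) :
    ∀ m : ℕ, ∀ c ∈ S, dist c p ^ 2 ≤ (m : ℝ) * (2 / 25) → ∃ y ∈ S, dist y p < 6 / 5 := by
  intro m
  induction m with
  | zero =>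
    intro c hc hd
    refine ⟨c, hc, ?_⟩
    have : dist c p ^ 2 ≤ 0 := by simpa using hd
    nlinarith [dist_nonneg (x := c) (y := p)]
  | succ m ih =>
    intro c hc hd
    by_cases hlt : dist c p < 6 / 5
    · exact ⟨c, hc, hlt⟩
    push Not at hlt
    obtain ⟨y, hy, -, hest⟩ := clean_exists_step hdir hc p
    have := clean_step_cover hlt
    refine ih y hy ?_
    push_cast at hd
    linarith

/-- **Covering radius `< 6/5`**: every point of space is within `6/5` of a nonempty clean set.
[folklore] -/
theorem clean_exists_near
    (hdir : ∀ x ∈ S, ∀ d : EuclideanSpace ℝ (Fin 3), ∃ y ∈ S, y ≠ x ∧ dist x y ≤ 28 / 25 ∧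
      139 / 250 * ‖d‖ ≤ inner ℝ (y - x) d)
    {x : EuclideanSpace ℝ (Fin 3)} (hx : x ∈ S) (p : EuclideanSpace ℝ (Fin 3)) :
    ∃ y ∈ S, dist y p < 6 / 5 :=
  clean_exists_near_aux hdir p ⌈dist x p ^ 2 / (2 / 25)⌉₊ x hx
    (by
      have := Nat.le_ceil (dist x p ^ 2 / (2 / 25))
      rw [div_le_iff₀ (by norm_num : (0 : ℝ) < 2 / 25)] at this
      linarith)

/-- **Bounded parts of a clean set are finite** (hard core `> 1`: packing bound). [folklore] -/
theorem clean_finite_inter_closedBall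
    (hrad : ∀ y ∈ S, ∀ w ∈ S, w ≠ y → 2744 / 2550 ≤ dist y w ∧ (dist y w ≤ 28 / 25 ∨ 3528 / 2550 ≤ dist y w))
    (x : EuclideanSpace ℝ (Fin 3)) (R : ℝ) : (S ∩ closedBall x R).Finite := by
  have hsep : Metric.IsSeparated ((1 : ℝ≥0) : ℝ≥0∞) (S ∩ closedBall x R) := by
    intro y hy z hz hne
    have hd := (hrad y hy.1 z hz.1 (Ne.symm hne)).1
    rw [edist_dist, ← ENNReal.ofReal_coe_nnreal]
    refine (ENNReal.ofReal_lt_ofReal_iff (dist_pos.2 hne)).2 ?_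
    push_cast
    linarith
  have hfin : volume (⋃ a ∈ S ∩ closedBall x R, ball a (((1 : ℝ≥0) : ℝ) / 2)) ≠ ⊤ := by
    refine (lt_of_le_of_lt (measure_mono ?_) (measure_ball_lt_top (x := x) (r := R + 1))).ne
    intro p hp
    obtain ⟨a, ha, hpa⟩ := Set.mem_iUnion₂.1 hp
    rw [mem_ball] at hpa ⊢
    have h1 : dist a x ≤ R := mem_closedBall.1 ha.2
    have h2 : (((1 : ℝ≥0) : ℝ) / 2) ≤ 1 := by push_cast; norm_num
    linarith [dist_triangle p a x]
  have hpack := Metric.packingNumber_ne_top_of_measure_ne_top volume (by norm_num) hfin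
  have hle := Metric.IsSeparated.encard_le_packingNumber subset_rfl hsep
  exact Set.encard_ne_top_iff.1 (ne_top_of_le_ne_top hpack hle)

/-- **Volume count.** For `x ∈ S` and `R ≥ 6/5`, the set `S ∩ B(x, R)` has at least
`((R − 6/5)/(6/5))³` points. [folklore] -/
theorem clean_cube_le_ncard
    (hrad : ∀ y ∈ S, ∀ w ∈ S, w ≠ y → 2744 / 2550 ≤ dist y w ∧ (dist y w ≤ 28 / 25 ∨ 3528 / 2550 ≤ dist y w))
    (hdir : ∀ x ∈ S, ∀ d : EuclideanSpace ℝ (Fin 3), ∃ y ∈ S, y ≠ x ∧ dist x y ≤ 28 / 25 ∧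
      139 / 250 * ‖d‖ ≤ inner ℝ (y - x) d)
    {x : EuclideanSpace ℝ (Fin 3)} (hx : x ∈ S) {R : ℝ} (hR : 6 / 5 ≤ R) :
    ((R - 6 / 5) / (6 / 5)) ^ 3 ≤ (Set.ncard (S ∩ closedBall x R) : ℝ) := by
  have hF := clean_finite_inter_closedBall hrad x R
  have hcov : closedBall x (R - 6 / 5) ⊆ ⋃ y ∈ hF.toFinset, closedBall y (6 / 5) := by
    intro p hp
    obtain ⟨y, hy, hyp⟩ := clean_exists_near hdir hx p
    have hyF : y ∈ hF.toFinset := by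
      rw [Set.Finite.mem_toFinset]
      refine ⟨hy, mem_closedBall.2 ?_⟩
      have := mem_closedBall.1 hp
      linarith [dist_triangle y p x]
    exact Set.mem_biUnion hyF (mem_closedBall'.2 hyp.le)
  have hvol : volume (closedBall x (R - 6 / 5)) ≤
      ∑ y ∈ hF.toFinset, volume (closedBall y (6 / 5 : ℝ)) :=
    (measure_mono hcov).trans (measure_biUnion_finset_le _ _)
  rw [Measure.addHaar_closedBall volume x (by linarith : (0 : ℝ) ≤ R - 6 / 5),
    Finset.sum_congr rfl (fun y _ =>
      Measure.addHaar_closedBall volume y (by norm_num : (0 : ℝ) ≤ 6 / 5)),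
    Finset.sum_const, nsmul_eq_mul, finrank_euclideanSpace_fin, ← mul_assoc] at hvol
  have hV0 : volume (ball (0 : EuclideanSpace ℝ (Fin 3)) 1) ≠ 0 :=
    (measure_ball_pos volume (0 : EuclideanSpace ℝ (Fin 3)) one_pos).ne'
  have hVt : volume (ball (0 : EuclideanSpace ℝ (Fin 3)) 1) ≠ ⊤ := measure_ball_lt_top.ne
  rw [ENNReal.mul_le_mul_iff_left hV0 hVt, ← ENNReal.ofReal_natCast,
    ← ENNReal.ofReal_mul (by positivity), ENNReal.ofReal_le_ofReal_iff (by positivity)] at hvol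
  rw [Set.ncard_eq_toFinset_card _ hF, div_pow, div_le_iff₀ (by positivity)]
  exact hvol

/-- **Cubic growth of the window graph of a clean set**: the ball of radius `n ≥ 12` about `x ∈ S` in
the window graph has at least `(n/13)³` points. [folklore] -/
theorem clean_cubicGrowth
    (hrad : ∀ y ∈ S, ∀ w ∈ S, w ≠ y → 2744 / 2550 ≤ dist y w ∧ (dist y w ≤ 28 / 25 ∨ 3528 / 2550 ≤ dist y w))
    (hdir : ∀ x ∈ S, ∀ d : EuclideanSpace ℝ (Fin 3), ∃ y ∈ S, y ≠ x ∧ dist x y ≤ 28 / 25 ∧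
      139 / 250 * ‖d‖ ≤ inner ℝ (y - x) d)
    {x : EuclideanSpace ℝ (Fin 3)} (hx : x ∈ S) {n : ℕ} (hn : 12 ≤ n) :
    ((n : ℝ) / 13) ^ 3 ≤ (Set.ncard (windowBall S x n) : ℝ) := by
  have hsub : S ∩ closedBall x (3528 / 2550 + ((n - 2 : ℕ) : ℝ) / 10) ⊆ windowBall S x n := by
    rintro y ⟨hy, hyR⟩
    rw [mem_closedBall, dist_comm] at hyR
    obtain ⟨w, hw⟩ := clean_exists_walk hrad hdir hy (n - 2) x hx hyR
    exact ⟨w, by omega⟩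
  have hWfin : (windowBall S x n).Finite := by
    refine (clean_finite_inter_closedBall hrad x (28 / 25 * n)).subset ?_
    rintro y ⟨w, hw⟩
    obtain ⟨hyS, hd⟩ := walk_mem_and_dist w hx
    refine ⟨hyS, mem_closedBall.2 ?_⟩
    rw [dist_comm]
    have : (w.length : ℝ) ≤ n := by exact_mod_cast hw
    linarith
  have hR : (6 : ℝ) / 5 ≤ 3528 / 2550 + ((n - 2 : ℕ) : ℝ) / 10 := by
    have : (0 : ℝ) ≤ ((n - 2 : ℕ) : ℝ) / 10 := by positivity
    linarith
  have hcount := clean_cube_le_ncard hrad hdir hx hR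
  have hmono : (Set.ncard (S ∩ closedBall x (3528 / 2550 + ((n - 2 : ℕ) : ℝ) / 10)) : ℝ) ≤
      Set.ncard (windowBall S x n) := by
    exact_mod_cast Set.ncard_le_ncard hsub hWfin
  refine le_trans ?_ (hcount.trans hmono)
  have hn0 : (12 : ℝ) ≤ n := by exact_mod_cast hn
  rw [Nat.cast_sub (by omega : 2 ≤ n)]
  push_cast
  have h1 : (n : ℝ) / 13 ≤ (3528 / 2550 + ((n : ℝ) - 2) / 10 - 6 / 5) / (6 / 5) := by linarith
  exact pow_le_pow_left₀ (by positivity) h1 3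

end Growth

end Summit.AtomisticToContinuum.Crystallization.Theorems.CleanHull

end
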